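import Summits.ValiantsHypothesis.ValiantsHypothesis.Theorems.LacunarySymmetroidMatrixDescartesPivotRankOneCriticalWindowsSideCount

/-!
# `MatrixDescartes` census — rank-one `(2,K)₁`: THE ROOT COUNT LOCALISES TO ONE PIVOT-DIRECTION CELL
# (`Z₊(det F) ≤ 1 + C_cell`: only the critical directions lying in ONE cell between consecutive pivot-direction scales are paid for)

HONEST FRAMING.  Object-search cell `pub-symmetroid`, seat `val-sym-mdr-p1` (generation 25); helper file `--supports` the crux item
stmt-ValiantsHypothesis-18050 (`Theses.LacunarySymmetroid.MatrixDescartes`, OPEN, on HOLD) with NO closure claim.  A sharpening of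
`…CriticalWindowsSideCount.rankOne_card_posRoots_le_max_add_one` (`Z₊ ≤ 1 + max(C_L, C_R)`) that needs NO intermediate value theorem: by
`…CriticalWindowsSeparation.not_straddle_pivotScale` no pivot-direction scale (`T̂(x*) = tₚ`, i.e. `∑ₖ Wₖ(x*)(tₖ² − tₚ²) = 0`) lies between two
positive roots of `det F`, so ALL Rolle points between roots form a set of critical scales WITH NO PIVOT-DIRECTION SCALE BETWEEN ANY TWO OF
THEM — a set inside ONE CELL of `(0,∞) ∖ {T̂ = tₚ}`.  Hence (**`rankOne_card_posRoots_le_cellBudget_add_one`**): if every finite set of critical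
scales of the window profile lying in one cell has at most `C` elements, then `Z₊(f) ≤ C + 1`.  Since a cell carries directions on ONE side of
the pivot letter, `C ≤ max(C_L, C_R)` recovers the side form; for letters on BOTH sides of the pivot letter the cells alternate in type and the
cell budget can be smaller than the side budget (located: seat memo ROOT-COUNT.md).  Census currency: **`pivotPosRoots_le_cellBudget_add_one`**.
A COUNTING INSTRUMENT for one sub-row; nothing here bears on `MatrixDescartes` in its window, on `DoorA26` / `DoorA34`, registers / ζ, or
`VP ≠ VNP`.

[folklore] Rolle (the tree's between-roots count `SideCount.card_posRoots_le_card_add_one_of_between`); tree theorems named above.  No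
definitions, no named facts.
-/

-- `Summit.ValiantsHypothesis.ValiantsHypothesis.…` repeats a component by the D-0017 layout
-- (single-conjunct summit), which the `dupNamespace` linter flags; the name is mandated.
set_option linter.dupNamespace false

namespace Summit.ValiantsHypothesis.ValiantsHypothesis.Theorems.LacunarySymmetroidMatrixDescartes.Pivot.CriticalWindows.CellCount

open Polynomial Finset Set Matrix
open scoped BigOperators
open Summit.ValiantsHypothesis.ValiantsHypothesis.Theorems.LacunarySymmetroidMatrixDescartes.Pivot (pivotPosRoots)
open Summit.ValiantsHypothesis.ValiantsHypothesis.Theorems.LacunarySymmetroidMatrixDescartes.Pivot.CriticalWindows.RootCount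
open Summit.ValiantsHypothesis.ValiantsHypothesis.Theorems.LacunarySymmetroidMatrixDescartes.Pivot.CriticalWindows.Separation
  (not_straddle_pivotScale)
open Summit.ValiantsHypothesis.ValiantsHypothesis.Theorems.LacunarySymmetroidMatrixDescartes.Pivot.CriticalWindows.SideCount
  (card_posRoots_le_card_add_one_of_between)

/-- **THE CELL-LOCALISED PIPELINE.**  Rank-one hyperbolic pencil data as in `RootCount.rankOne_card_posRoots_le_of_sideBudgets`.  CELL BUDGET:
every finite set `S` of positive scales, each carrying a critical point `(x, T)` of the window profile (`T > 0`, both critical equations), such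
that NO pivot-direction scale lies weakly between two elements of `S` (`∀ x₁ x₂ ∈ S, ∀ y, x₁ ≤ y ≤ x₂ → ∑ₖ wₖy^{dₖ}(tₖ² − tₚ²) ≠ 0`), has at
most `C` elements.  Then **`Z₊(f) ≤ C + 1`**. [this file] -/
theorem rankOne_card_posRoots_le_cellBudget_add_one {ι : Type*} (s : Finset ι) (w t : ι → ℝ) (d : ι → ℕ) (e : ℕ) (p : ι)
    (hp : p ∈ s) (hw : ∀ m ∈ s, 0 < w m) (ht : ∀ m ∈ s, 0 < t m) (hdm : ∀ m ∈ s, m ≠ p → e < d m)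
    (hnp : ∃ m ∈ s, t m ≠ t p) (f : ℝ[X])
    (hf : ∀ x, 0 < x → (f.IsRoot x ↔ (∑ k ∈ s, w k * x ^ d k) * (∑ k ∈ s, w k * t k ^ 2 * x ^ d k)
      - ((∑ k ∈ s, w k * t k * x ^ d k) + x ^ e) ^ 2 = 0))
    (C : ℕ)
    (hC : ∀ S : Finset ℝ,
      (∀ x ∈ S, 0 < x ∧ ∃ T, 0 < T ∧
        (∑ m ∈ s, w m * x ^ d m * (T ^ 2 - t m ^ 2) = 0) ∧
        (∑ m ∈ s, ((d m : ℝ) - e) * (w m * x ^ d m) * (T - t m) ^ 2 = 0)) →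
      (∀ x₁ ∈ S, ∀ x₂ ∈ S, ∀ y, x₁ ≤ y → y ≤ x₂ → ∑ k ∈ s, w k * y ^ d k * (t k ^ 2 - t p ^ 2) ≠ 0) →
      S.card ≤ C) :
    (f.roots.toFinset.filter (fun t => 0 < t)).card ≤ C + 1 := by
  classical
  have hs : s.Nonempty := ⟨p, hp⟩
  set τ : ℝ → ℝ := fun x => Real.sqrt ((∑ k ∈ s, w k * t k ^ 2 * x ^ d k) / (∑ k ∈ s, w k * x ^ d k)) with hτdef
  have hτpos : ∀ x, 0 < x → 0 < τ x := by
    intro x hx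
    obtain ⟨hA, -, hCm⟩ := moments_pos s hs w t d hw ht hx
    exact Real.sqrt_pos.2 (div_pos hCm hA)
  have hτC : ∀ x, 0 < x → (∑ k ∈ s, w k * x ^ d k) * τ x ^ 2 = ∑ k ∈ s, w k * t k ^ 2 * x ^ d k := by
    intro x hx
    obtain ⟨hA, -, hCm⟩ := moments_pos s hs w t d hw ht hx
    rw [hτdef, Real.sq_sqrt (div_pos hCm hA).le]
    field_simp
  have hE1 : ∀ x, 0 < x → ∑ m ∈ s, w m * x ^ d m * (τ x ^ 2 - t m ^ 2) = 0 := by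
    intro x hx
    have h := hτC x hx
    have : ∑ m ∈ s, w m * x ^ d m * (τ x ^ 2 - t m ^ 2)
        = (∑ k ∈ s, w k * x ^ d k) * τ x ^ 2 - ∑ k ∈ s, w k * t k ^ 2 * x ^ d k := by
      rw [Finset.sum_mul, ← Finset.sum_sub_distrib]
      exact Finset.sum_congr rfl fun k _ => by ring
    rw [this, h, sub_self]
  set φ : ℝ → ℝ := fun y => (Real.sqrt ((∑ k ∈ s, w k * y ^ d k) * (∑ k ∈ s, w k * t k ^ 2 * y ^ d k))
      - ∑ k ∈ s, w k * t k * y ^ d k) / y ^ e - 1 with hφdef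
  set φ' : ℝ → ℝ := fun x => (∑ k ∈ s, ((d k : ℝ) - e) * (w k * x ^ d k) * (τ x - t k) ^ 2) / (2 * τ x * x ^ (e + 1))
    with hφ'def
  have hφ : ∀ x, 0 < x → (φ x = 0 ↔ f.IsRoot x) := by
    intro x hx
    obtain ⟨hA, hU, hCm⟩ := moments_pos s hs w t d hw ht hx
    rw [hf x hx, hφdef]
    exact gapProfile_eq_zero_iff _ _ _ _ (mul_pos hA hCm).le (add_pos hU (pow_pos hx e)).le (pow_pos hx e)
  have hder : ∀ x, 0 < x → HasDerivAt φ (φ' x) x := fun x hx =>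
    hasDerivAt_gapProfile s hs w t d e hw ht hx (hτpos x hx) (hτC x hx)
  have hE2 : ∀ c, 0 < c → φ' c = 0 → ∑ m ∈ s, ((d m : ℝ) - e) * (w m * c ^ d m) * (τ c - t m) ^ 2 = 0 := by
    intro c hc h0
    rw [hφ'def, div_eq_zero_iff] at h0
    rcases h0 with h0 | h0
    · exact h0
    · exact absurd h0 (mul_pos (mul_pos two_pos (hτpos c hc)) (pow_pos hc _)).ne'
  have hroot_gap : ∀ x, 0 < x → f.IsRoot x →
      Real.sqrt ((∑ k ∈ s, w k * x ^ d k) * (∑ k ∈ s, w k * t k ^ 2 * x ^ d k)) - ∑ k ∈ s, w k * t k * x ^ d k = x ^ e := by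
    intro x hx hr
    have h := (hφ x hx).2 hr
    rw [hφdef] at h
    have hxe : x ^ e ≠ 0 := (pow_pos hx e).ne'
    have h' : (Real.sqrt ((∑ k ∈ s, w k * x ^ d k) * (∑ k ∈ s, w k * t k ^ 2 * x ^ d k))
        - ∑ k ∈ s, w k * t k * x ^ d k) / x ^ e = 1 := by linarith
    rwa [div_eq_one_iff_eq hxe] at h'
  -- the set of critical scales lying strictly between two positive roots
  set Sroots := f.roots.toFinset.filter (fun t => 0 < t) with hSroots
  have hmemS : ∀ a, a ∈ Sroots → 0 < a ∧ f.IsRoot a := by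
    intro a ha
    have h := Finset.mem_filter.1 ha
    rw [Multiset.mem_toFinset] at h
    exact ⟨h.2, isRoot_of_mem_roots h.1⟩
  set crit : Set ℝ := {c | 0 < c ∧ φ' c = 0 ∧ ∃ a b, a ∈ Sroots ∧ b ∈ Sroots ∧ a < c ∧ c < b} with hcrit
  -- no pivot-direction scale between the extreme roots, hence between any two points of `crit`
  have hnostar : ∀ c₁ ∈ crit, ∀ c₂ ∈ crit, ∀ y, c₁ ≤ y → y ≤ c₂ → ∑ k ∈ s, w k * y ^ d k * (t k ^ 2 - t p ^ 2) ≠ 0 := by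
    intro c₁ hc₁ c₂ hc₂ y h1 h2 hstar
    obtain ⟨hc₁pos, -, a₁, b₁, ha₁, hb₁, ha₁c, hcb₁⟩ := hc₁
    obtain ⟨-, -, a₂, b₂, ha₂, hb₂, ha₂c, hcb₂⟩ := hc₂
    obtain ⟨ha₁pos, hra₁⟩ := hmemS a₁ ha₁
    obtain ⟨-, hrb₂⟩ := hmemS b₂ hb₂
    have hy : 0 < y := lt_of_lt_of_le hc₁pos h1
    have h := not_straddle_pivotScale s w t d e p hp hw ht hdm hnp ha₁pos (ha₁c.le.trans h1) (h2.trans hcb₂.le) hstar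
      (hroot_gap a₁ ha₁pos hra₁) (hroot_gap b₂ (lt_of_lt_of_le hy (h2.trans hcb₂.le)) hrb₂)
    have : a₁ < b₂ := ha₁c.trans_le (h1.trans (h2.trans hcb₂.le))
    exact absurd h this.ne
  -- `crit` is finite: every finite subset has ≤ C elements
  have hsub : ∀ S : Finset ℝ, (∀ c ∈ S, c ∈ crit) → S.card ≤ C := by
    intro S hS
    refine hC S (fun x hx => ?_) (fun x₁ hx₁ x₂ hx₂ y h1 h2 => hnostar x₁ (hS x₁ hx₁) x₂ (hS x₂ hx₂) y h1 h2)
    obtain ⟨hx, h0, -⟩ := hS x hx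
    exact ⟨hx, τ x, hτpos x hx, hE1 x hx, hE2 x hx h0⟩
  have hfin : crit.Finite := by
    by_contra hinf
    obtain ⟨S, hS, hcard⟩ := Set.Infinite.exists_subset_card_eq hinf (C + 1)
    have := hsub S fun c hc => hS hc
    omega
  have hcard : hfin.toFinset.card ≤ C := hsub _ fun c hc => by simpa using hc
  have h := card_posRoots_le_card_add_one_of_between f φ φ' hφ hder hfin.toFinset fun c hc h0 hbetween => by
    obtain ⟨a, b, haS, hbS, hac, hcb⟩ := hbetween
    exact hfin.mem_toFinset.2 ⟨hc, h0, a, b, haS, hbS, hac, hcb⟩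
  rw [← hSroots] at h
  omega

/-- **THE CELL-LOCALISED PIPELINE IN CENSUS CURRENCY** (`Fin K` letters, `J = [[0,1],[1,0]]`, `P k = wₖ·(1,tₖ)(1,tₖ)ᵀ`). [this file] -/
theorem pivotPosRoots_le_cellBudget_add_one (K e : ℕ) (d : Fin K → ℕ) (w t : Fin K → ℝ) (p : Fin K)
    (hw : ∀ m, 0 < w m) (ht : ∀ m, 0 < t m) (hdm : ∀ m, m ≠ p → e < d m) (hnp : ∃ m, t m ≠ t p) (C : ℕ)
    (hC : ∀ S : Finset ℝ,
      (∀ x ∈ S, 0 < x ∧ ∃ T, 0 < T ∧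
        (∑ m, w m * x ^ d m * (T ^ 2 - t m ^ 2) = 0) ∧
        (∑ m, ((d m : ℝ) - e) * (w m * x ^ d m) * (T - t m) ^ 2 = 0)) →
      (∀ x₁ ∈ S, ∀ x₂ ∈ S, ∀ y, x₁ ≤ y → y ≤ x₂ → ∑ k, w k * y ^ d k * (t k ^ 2 - t p ^ 2) ≠ 0) →
      S.card ≤ C) :
    pivotPosRoots e d (!![(0 : ℝ), 1; 1, 0]) (fun k => w k • vecMulVec ![1, t k] ![1, t k]) ≤ C + 1 := by
  unfold pivotPosRoots
  refine rankOne_card_posRoots_le_cellBudget_add_one (Finset.univ : Finset (Fin K)) w t d e p (Finset.mem_univ p)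
    (fun m _ => hw m) (fun m _ => ht m) (fun m _ hm => hdm m hm) ?_ _ ?_ C ?_
  · obtain ⟨m, hm⟩ := hnp
    exact ⟨m, Finset.mem_univ m, hm⟩
  · intro x hx
    rw [Polynomial.IsRoot.def, det_rankOne_hyperbolic_eval]
  · intro S hS hcell
    exact hC S (fun x hx => hS x hx) (fun x₁ h₁ x₂ h₂ y hy₁ hy₂ => hcell x₁ h₁ x₂ h₂ y hy₁ hy₂)

end Summit.ValiantsHypothesis.ValiantsHypothesis.Theorems.LacunarySymmetroidMatrixDescartes.Pivot.CriticalWindows.CellCount
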